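import Summits.QuantumFields.YangMills.Theorems.BalabanUVNodesN21GappedTopPairReading13CoPHDefs
import Summits.QuantumFields.YangMills.Theorems.BalabanUVNodesN21ShellSplitSelected13CoPHDefsCmap

/-!
# N21 THRESHOLD SHELLS — THE DOUBLY-GAPPED SPINE READING, χ-GENERIC («Cmap» ∕ Chi EDITION): the two majorant masses, badnesses and SEPARATELY selected depths
# (`majA2∕majB2Sum…₁₃Chi`, `a∕bBadness2₁₃Chi`, `selDepthA2∕B2₁₃Chi`), the doubly-gapped carriers (`gapWeight2∕gapShell2∕gapCore2 A∕B₁₃Chi`) and the reading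
# `crGap2₁₃VAtCmap Χ K₀ jcut ρ ρ' n₁ n₂ : SpineReading₁₃CoPHCmap N Χ` — §D2–§D4 of `Thm/BalabanUVNodesN21GappedTopPairReading13CoPHDefs` (dag-n21-d) RE-ISSUED over the β-slot
# (plan g99 census row 6), receipts at `χ := chiβOfRecord₁₃ θ` (`rfl`), RE-CENTRED `…Ax`

Cell `pub-ymgap`, YM-PLAN Track A (HUMAN RULING D-0062); seat `pub-ymgap-dag-n15-a` (g38) — op 5c (a) T4 of HANDS-4 (dag-lead g40 WORDS 591; g41 WORDS 610 (4) T4 REBALANCE: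
dag-n15-c silent ⇒ n15-a files the three T4 basenames), supply for K3ᴬ `SpineGivenEndpointR13SepCoPHVAx` (stmt-QuantumFields-27247; plan g99 memo `OP5C-SUPPLY-CENSUS-K3v8.md`
§2 rows 6–8 ∕ §3 ∕ σ4–σ5; node00-def-RR-2 GATE-0 Q-TRANSPORT = NO, I.21769).  `--kind definition --supports stmt-QuantumFields-27247 --as helper`; COUNT-NEUTRAL.  NOTHING of record
is edited (body-freeze; NEW basename beside the untouched parent): every declaration below is the VERBATIM body of the like-named parent declaration with exactly the substitutions
of T3 `…SpineReadingOfRecord13CoPHChi` (dag-n20-d ✓p806069): `(hP : θ.Provisos₁₃CoPH F N) ↦ (χ : ChiSlot F N) (hP : θ.Provisos₁₃CoPHChi F N χ)`, `histA∕B₁₃ θ ↦ histA∕B₁₃Chi θ χ`,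
`keyA∕B₁₃ θ ↦ keyA∕B₁₃Chi θ χ`, `classSet₁₃ ∕ badClass₁₃ θ ↦ …Chi θ χ`, `datumOfRecord₁₃CoPH θ hP ↦ datumOfRecord₁₃CoPHChi θ χ hP`; names `X₁₃ ↦ X₁₃Chi` (θ-level, slot `χ`) ∕
`XCmap` (family-level, slot READING `Χ : (F : T4Family) → Stage13Params F N → ChiSlot F N`, read at `Χ F θ.toStage13Params`; letter TYPES `…Letter₁₃CoPHCmap N Χ`, readings
`ShellSplit₁₃CoPHCmap N Χ K₀` ∕ `SpineReading₁₃CoPHCmap N Χ` ∕ `crOfRecord₁₃AtCmap Χ …` from T2∕T3 BY NAME, not re-declared); receipts at the record's own slot `χ := chiβOfRecord₁₃ θ` (`rfl`,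
provisos transported through `provisos₁₃CoPHChi_chiβ_iff`); RE-CENTRED instances `abbrev XAx := X… (chiβOfRecord₁₃Ax …)`.

WHAT IS DEFINED ∕ PROVED (definitions + `rfl` ∕ `choose_spec` ∕ `sum_sub_distrib` bookkeeping; zero `sorry`).  §D2χ `majA2SumA∕B₁₃Chi`, `majB2SumA∕B₁₃Chi`, `aBadness2₁₃Chi`,
`bBadness2₁₃Chi`, `selDepthA2∕B2₁₃Chi` (+ `_spec ∕ _le`), `gap2ShellSumA∕B₁₃Chi` · §D3χ `gapWeight2A∕B₁₃Chi`, `gapShell2A∕B₁₃Chi`, `gapCore2A∕B₁₃Chi` + ★★ `gapWeight2A₁₃Chi_sub_gapShell2A₁₃Chi`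
∕ `…B…` · §D4χ `crGap2₁₃VAtCmap Χ K₀ jcut ρ ρ' n₁ n₂ ∕ crGap2₁₃VCmap : SpineReading₁₃CoPHCmap N Χ` + the `rfl` dictionary (`_ι ∕ _l₀ ∕ _vol ∕ _K₀ ∕ _T ∕ _A ∕ _B ∕ _shA ∕ _shB ∕ _Bad`,
`crGap2₁₃VCmap_eq`; the parent's comparison with `crGap₁₃VAt` is NOT re-issued — the single-gap reading has no χ-edition) · §R receipt `crGap2₁₃VAtCmap_chiβ` · §A `crGap2₁₃VAtAx ∕
crGap2₁₃VAx : SpineReading₁₃CoPHAx N` (the K3ᴬ v8 `PinnedAtLiveGap2 ∕ DialRows` objects).  The parent's §D1 level objects (`topTerm2AtLevel`, `topGap2ShellAtLevel`, `topGap2CoreAtLevel`,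
`majorantA2∕B2AtLevel`) are DATUM-GENERIC (χ-free) and USED BY NAME.

HONEST FRAMING.  DEFINITIONS re-issued over a parameter + `rfl` bookkeeping; NO estimate; nothing of Bałaban's asserted, ported or discharged; no `Provisos₁₃CoPHChi ∕ …Ax`
inhabitant claimed (K0 open); K-Ax cruxes 3∕3 OPEN; N21 ∕ N19 ∕ N27 NOT discharged; N15's record untouched; counts UNMOVED (typed 28∕28 · discharged 8∕27); one finite four-torus
programme at fixed `ε` — NOT ℝ⁴, NOT OS, NOT a mass gap, NOT the Clay problem.  No `instance`, no `notation`, no `sorry`, no `axiom`; no decl below carries a cite tag.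
-/

noncomputable section

open scoped BigOperators
open Finset MeasureTheory

namespace Summit.QuantumFields.YangMills.Theorems.N21GappedTopPair13CoPH

open Literature.MathematicalPhysics.QuantumFieldTheory.Balaban1983to89
open Literature.MathematicalPhysics.QuantumFieldTheory.Balaban1983to89.T4Continuum
open Literature.MathematicalPhysics.QuantumFieldTheory.Balaban1983to89.Node00
open YMDAG.UVSplit (SpineReading₁₃CoPH keyA₁₃ keyB₁₃ runA₁₃ runB₁₃ histA₁₃ histB₁₃ classSet₁₃ badClass₁₃
  SpineReading₁₃CoPHCmap SpineReading₁₃CoPHAx keyA₁₃Chi keyB₁₃Chi histA₁₃Chi histB₁₃Chi classSet₁₃Chi badClass₁₃Chi)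
open Summit.QuantumFields.BalabanUV.T4Continuum.Spine
open Summit.QuantumFields.YangMills.BalabanUVNodes.SpineCanonicalWeights
open Summit.QuantumFields.YangMills.Theorems.N21ShellSplitOfRecord13CoPH

/-! ## §D2χ–§D4χ At the χ-keyed Stage-13 record -/

section Reading2

variable {F : T4Family} {N : ℕ} [NeZero N]
  {Χ : (F : T4Family) → Stage13Params F N → ChiSlot F N}

/-- **RUN A's a-MAJORANT MASS AT DEPTH `i`** (comparison `K`, top `K₀ + K`, width `ρ K`, source `t`; collar `(θ_{i+2}, θ_i)`). [bookkeeping] -/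
def majA2SumA₁₃Chi (θ : Stage13HParams F N) (χ : ChiSlot F N) (hP : θ.Provisos₁₃CoPHChi F N χ) (K₀ : ℕ) (g₀ : ℕ → ℝ) (os : List (ULoop F)) (ρ : ℕ → ℝ) (K i : ℕ) (t : ℝ) : ℝ :=
  majorantA2AtLevel F N θ.toStage9Params (datumOfRecord₁₃CoPHChi F N θ χ hP) g₀ os (runA₁₃ F K₀ g₀ K) (histA₁₃Chi θ χ K₀ g₀ K)
    (cutGrid θ.ν (histA₁₃Chi θ χ K₀ g₀ K) (K₀ + K) (ρ K) (i + 2)) (cutGrid θ.ν (histA₁₃Chi θ χ K₀ g₀ K) (K₀ + K) (ρ K) i) t (K₀ + K)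

/-- **RUN B's a-MAJORANT MASS AT DEPTH `i`** (top `K₀ + K + 1`). [bookkeeping] -/
def majA2SumB₁₃Chi (θ : Stage13HParams F N) (χ : ChiSlot F N) (hP : θ.Provisos₁₃CoPHChi F N χ) (K₀ : ℕ) (g₀ : ℕ → ℝ) (os : List (ULoop F)) (ρ : ℕ → ℝ) (K i : ℕ) (t : ℝ) : ℝ :=
  majorantA2AtLevel F N θ.toStage9Params (datumOfRecord₁₃CoPHChi F N θ χ hP) g₀ os (runB₁₃ F K₀ g₀ K) (histB₁₃Chi θ χ K₀ g₀ K)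
    (cutGrid θ.ν (histB₁₃Chi θ χ K₀ g₀ K) (K₀ + K + 1) (ρ K) (i + 2)) (cutGrid θ.ν (histB₁₃Chi θ χ K₀ g₀ K) (K₀ + K + 1) (ρ K) i) t (K₀ + K + 1)

/-- **RUN A's b-MAJORANT MASS AT DEPTH `j`** (width `ρ′ K`; collar `(δ′_{j+2}, δ′_j)` on the (3.3) grid of the old level `K₀ + K − 1`). [bookkeeping] -/
def majB2SumA₁₃Chi (θ : Stage13HParams F N) (χ : ChiSlot F N) (hP : θ.Provisos₁₃CoPHChi F N χ) (K₀ : ℕ) (g₀ : ℕ → ℝ) (os : List (ULoop F)) (ρ' : ℕ → ℝ) (K j : ℕ) (t : ℝ) : ℝ :=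
  majorantB2AtLevel F N θ.toStage9Params (datumOfRecord₁₃CoPHChi F N θ χ hP) g₀ os (runA₁₃ F K₀ g₀ K) (histA₁₃Chi θ χ K₀ g₀ K)
    (bCutGrid θ.ν θ.A₁ (histA₁₃Chi θ χ K₀ g₀ K) (K₀ + K - 1) (ρ' K) (j + 2)) (bCutGrid θ.ν θ.A₁ (histA₁₃Chi θ χ K₀ g₀ K) (K₀ + K - 1) (ρ' K) j) t (K₀ + K)

/-- **RUN B's b-MAJORANT MASS AT DEPTH `j`** (old level `K₀ + K`). [bookkeeping] -/
def majB2SumB₁₃Chi (θ : Stage13HParams F N) (χ : ChiSlot F N) (hP : θ.Provisos₁₃CoPHChi F N χ) (K₀ : ℕ) (g₀ : ℕ → ℝ) (os : List (ULoop F)) (ρ' : ℕ → ℝ) (K j : ℕ) (t : ℝ) : ℝ :=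
  majorantB2AtLevel F N θ.toStage9Params (datumOfRecord₁₃CoPHChi F N θ χ hP) g₀ os (runB₁₃ F K₀ g₀ K) (histB₁₃Chi θ χ K₀ g₀ K)
    (bCutGrid θ.ν θ.A₁ (histB₁₃Chi θ χ K₀ g₀ K) (K₀ + K) (ρ' K) (j + 2)) (bCutGrid θ.ν θ.A₁ (histB₁₃Chi θ χ K₀ g₀ K) (K₀ + K) (ρ' K) j) t (K₀ + K + 1)

/-- **THE TWO-RUN BADNESS OF AN a-DEPTH**: the two runs' a-majorant masses at depth `i`, each normalised by its run's dressed partition function (`x ∕ 0 = 0`). [bookkeeping] -/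
def aBadness2₁₃Chi (θ : Stage13HParams F N) (χ : ChiSlot F N) (hP : θ.Provisos₁₃CoPHChi F N χ) (K₀ : ℕ) (g₀ : ℕ → ℝ) (os : List (ULoop F)) (ρ : ℕ → ℝ) (K : ℕ) (t : ℝ) (i : ℕ) : ℝ :=
  majA2SumA₁₃Chi θ χ hP K₀ g₀ os ρ K i t / T4GenFunBounds.schemeZ ((datumOfRecord₁₃CoPHChi F N θ χ hP).scheme g₀) os (K₀ + K) t +
    majA2SumB₁₃Chi θ χ hP K₀ g₀ os ρ K i t / T4GenFunBounds.schemeZ ((datumOfRecord₁₃CoPHChi F N θ χ hP).scheme g₀) os (K₀ + K + 1) t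

/-- **THE TWO-RUN BADNESS OF A b-DEPTH.** [bookkeeping] -/
def bBadness2₁₃Chi (θ : Stage13HParams F N) (χ : ChiSlot F N) (hP : θ.Provisos₁₃CoPHChi F N χ) (K₀ : ℕ) (g₀ : ℕ → ℝ) (os : List (ULoop F)) (ρ' : ℕ → ℝ) (K : ℕ) (t : ℝ) (j : ℕ) : ℝ :=
  majB2SumA₁₃Chi θ χ hP K₀ g₀ os ρ' K j t / T4GenFunBounds.schemeZ ((datumOfRecord₁₃CoPHChi F N θ χ hP).scheme g₀) os (K₀ + K) t +
    majB2SumB₁₃Chi θ χ hP K₀ g₀ os ρ' K j t / T4GenFunBounds.schemeZ ((datumOfRecord₁₃CoPHChi F N θ χ hP).scheme g₀) os (K₀ + K + 1) t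

/-- ★ **THE SELECTED a-DEPTH** `i⋆(K, t) ≤ n₁`: an argmin of the a-badness over `0, …, n₁`. [bookkeeping] -/
def selDepthA2₁₃Chi (θ : Stage13HParams F N) (χ : ChiSlot F N) (hP : θ.Provisos₁₃CoPHChi F N χ) (K₀ : ℕ) (g₀ : ℕ → ℝ) (os : List (ULoop F)) (ρ : ℕ → ℝ) (n₁ K : ℕ) (t : ℝ) : ℕ :=
  Classical.choose ((Finset.range (n₁ + 1)).exists_min_image (aBadness2₁₃Chi θ χ hP K₀ g₀ os ρ K t) ⟨0, Finset.mem_range.2 (Nat.succ_pos n₁)⟩)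

/-- ★ **THE SELECTED b-DEPTH** `j⋆(K, t) ≤ n₂`: an argmin of the b-badness over `0, …, n₂` — selected INDEPENDENTLY of `i⋆` (the majorants separate). [bookkeeping] -/
def selDepthB2₁₃Chi (θ : Stage13HParams F N) (χ : ChiSlot F N) (hP : θ.Provisos₁₃CoPHChi F N χ) (K₀ : ℕ) (g₀ : ℕ → ℝ) (os : List (ULoop F)) (ρ' : ℕ → ℝ) (n₂ K : ℕ) (t : ℝ) : ℕ :=
  Classical.choose ((Finset.range (n₂ + 1)).exists_min_image (bBadness2₁₃Chi θ χ hP K₀ g₀ os ρ' K t) ⟨0, Finset.mem_range.2 (Nat.succ_pos n₂)⟩)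

/-- Spec of the selected a-depth. [bookkeeping] -/
theorem selDepthA2₁₃Chi_spec (θ : Stage13HParams F N) (χ : ChiSlot F N) (hP : θ.Provisos₁₃CoPHChi F N χ) (K₀ : ℕ) (g₀ : ℕ → ℝ) (os : List (ULoop F)) (ρ : ℕ → ℝ) (n₁ K : ℕ) (t : ℝ) :
    selDepthA2₁₃Chi θ χ hP K₀ g₀ os ρ n₁ K t ∈ Finset.range (n₁ + 1) ∧
      ∀ i ∈ Finset.range (n₁ + 1), aBadness2₁₃Chi θ χ hP K₀ g₀ os ρ K t (selDepthA2₁₃Chi θ χ hP K₀ g₀ os ρ n₁ K t) ≤ aBadness2₁₃Chi θ χ hP K₀ g₀ os ρ K t i :=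
  Classical.choose_spec ((Finset.range (n₁ + 1)).exists_min_image (aBadness2₁₃Chi θ χ hP K₀ g₀ os ρ K t) ⟨0, Finset.mem_range.2 (Nat.succ_pos n₁)⟩)

/-- Spec of the selected b-depth. [bookkeeping] -/
theorem selDepthB2₁₃Chi_spec (θ : Stage13HParams F N) (χ : ChiSlot F N) (hP : θ.Provisos₁₃CoPHChi F N χ) (K₀ : ℕ) (g₀ : ℕ → ℝ) (os : List (ULoop F)) (ρ' : ℕ → ℝ) (n₂ K : ℕ) (t : ℝ) :
    selDepthB2₁₃Chi θ χ hP K₀ g₀ os ρ' n₂ K t ∈ Finset.range (n₂ + 1) ∧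
      ∀ j ∈ Finset.range (n₂ + 1), bBadness2₁₃Chi θ χ hP K₀ g₀ os ρ' K t (selDepthB2₁₃Chi θ χ hP K₀ g₀ os ρ' n₂ K t) ≤ bBadness2₁₃Chi θ χ hP K₀ g₀ os ρ' K t j :=
  Classical.choose_spec ((Finset.range (n₂ + 1)).exists_min_image (bBadness2₁₃Chi θ χ hP K₀ g₀ os ρ' K t) ⟨0, Finset.mem_range.2 (Nat.succ_pos n₂)⟩)

/-- The selected a-depth is at most `n₁`. [bookkeeping] -/
theorem selDepthA2₁₃Chi_le (θ : Stage13HParams F N) (χ : ChiSlot F N) (hP : θ.Provisos₁₃CoPHChi F N χ) (K₀ : ℕ) (g₀ : ℕ → ℝ) (os : List (ULoop F)) (ρ : ℕ → ℝ) (n₁ K : ℕ) (t : ℝ) :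
    selDepthA2₁₃Chi θ χ hP K₀ g₀ os ρ n₁ K t ≤ n₁ :=
  Nat.lt_succ_iff.1 (Finset.mem_range.1 (selDepthA2₁₃Chi_spec θ χ hP K₀ g₀ os ρ n₁ K t).1)

/-- The selected b-depth is at most `n₂`. [bookkeeping] -/
theorem selDepthB2₁₃Chi_le (θ : Stage13HParams F N) (χ : ChiSlot F N) (hP : θ.Provisos₁₃CoPHChi F N χ) (K₀ : ℕ) (g₀ : ℕ → ℝ) (os : List (ULoop F)) (ρ' : ℕ → ℝ) (n₂ K : ℕ) (t : ℝ) :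
    selDepthB2₁₃Chi θ χ hP K₀ g₀ os ρ' n₂ K t ≤ n₂ :=
  Nat.lt_succ_iff.1 (Finset.mem_range.1 (selDepthB2₁₃Chi_spec θ χ hP K₀ g₀ os ρ' n₂ K t).1)

/-- **RUN A's TWO-COLLAR SHELL MASS AT A DEPTH PAIR `(i, j)`.** [bookkeeping] -/
def gap2ShellSumA₁₃Chi (θ : Stage13HParams F N) (χ : ChiSlot F N) (hP : θ.Provisos₁₃CoPHChi F N χ) (K₀ : ℕ) (g₀ : ℕ → ℝ) (os : List (ULoop F)) (ρ ρ' : ℕ → ℝ) (K i j : ℕ) (t : ℝ) : ℝ :=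
  ∑ s : SeqOfRecord F θ.ν θ.τ9.M (histA₁₃Chi θ χ K₀ g₀ K) (K₀ + K) (K₀ + K),
    topGap2ShellAtLevel F N θ.toStage9Params (datumOfRecord₁₃CoPHChi F N θ χ hP) g₀ os (runA₁₃ F K₀ g₀ K) (histA₁₃Chi θ χ K₀ g₀ K)
      (cutGrid θ.ν (histA₁₃Chi θ χ K₀ g₀ K) (K₀ + K) (ρ K) (i + 2)) (cutGrid θ.ν (histA₁₃Chi θ χ K₀ g₀ K) (K₀ + K) (ρ K) (i + 1))
      (cutGrid θ.ν (histA₁₃Chi θ χ K₀ g₀ K) (K₀ + K) (ρ K) i)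
      (bCutGrid θ.ν θ.A₁ (histA₁₃Chi θ χ K₀ g₀ K) (K₀ + K - 1) (ρ' K) (j + 2)) (bCutGrid θ.ν θ.A₁ (histA₁₃Chi θ χ K₀ g₀ K) (K₀ + K - 1) (ρ' K) (j + 1))
      (bCutGrid θ.ν θ.A₁ (histA₁₃Chi θ χ K₀ g₀ K) (K₀ + K - 1) (ρ' K) j) t (K₀ + K) s

/-- **RUN B's TWO-COLLAR SHELL MASS AT A DEPTH PAIR `(i, j)`.** [bookkeeping] -/
def gap2ShellSumB₁₃Chi (θ : Stage13HParams F N) (χ : ChiSlot F N) (hP : θ.Provisos₁₃CoPHChi F N χ) (K₀ : ℕ) (g₀ : ℕ → ℝ) (os : List (ULoop F)) (ρ ρ' : ℕ → ℝ) (K i j : ℕ) (t : ℝ) : ℝ :=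
  ∑ s' : SeqOfRecord F θ.ν θ.τ9.M (histB₁₃Chi θ χ K₀ g₀ K) (K₀ + K + 1) (K₀ + K + 1),
    topGap2ShellAtLevel F N θ.toStage9Params (datumOfRecord₁₃CoPHChi F N θ χ hP) g₀ os (runB₁₃ F K₀ g₀ K) (histB₁₃Chi θ χ K₀ g₀ K)
      (cutGrid θ.ν (histB₁₃Chi θ χ K₀ g₀ K) (K₀ + K + 1) (ρ K) (i + 2)) (cutGrid θ.ν (histB₁₃Chi θ χ K₀ g₀ K) (K₀ + K + 1) (ρ K) (i + 1))
      (cutGrid θ.ν (histB₁₃Chi θ χ K₀ g₀ K) (K₀ + K + 1) (ρ K) i)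
      (bCutGrid θ.ν θ.A₁ (histB₁₃Chi θ χ K₀ g₀ K) (K₀ + K) (ρ' K) (j + 2)) (bCutGrid θ.ν θ.A₁ (histB₁₃Chi θ χ K₀ g₀ K) (K₀ + K) (ρ' K) (j + 1))
      (bCutGrid θ.ν θ.A₁ (histB₁₃Chi θ χ K₀ g₀ K) (K₀ + K) (ρ' K) j) t (K₀ + K + 1) s'

/-! ## §D3 The keyed carriers at the selected middle letters -/

/-- **RUN A's DOUBLY-GAPPED CLASS WEIGHT** at a key: the fibre sum along `keyA₁₃Chi` of the pair-lettered terms at the selected middle letters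
`(ε(1 − ρ_K)^{i⋆+1}, 2δ(1 − ρ′_K)^{j⋆+1})`. [bookkeeping] -/
def gapWeight2A₁₃Chi (θ : Stage13HParams F N) (χ : ChiSlot F N) (hP : θ.Provisos₁₃CoPHChi F N χ) (K₀ : ℕ) (g₀ : ℕ → ℝ) (os : List (ULoop F)) (ρ ρ' : ℕ → ℝ) (n₁ n₂ : ℕ → ℕ)
    (K : ℕ) (t : ℝ) (x : Σ K, SiteSeqKey F (K₀ + K)) : ℝ :=
  letI : ∀ Kc, DecidableEq (SiteSeqKey F Kc) := fun _ => Classical.decEq _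
  ∑ s ∈ univ.filter (fun s => keyA₁₃Chi θ χ K₀ g₀ K s = x),
    topTerm2AtLevel F N θ.toStage9Params (datumOfRecord₁₃CoPHChi F N θ χ hP) g₀ os (runA₁₃ F K₀ g₀ K) (histA₁₃Chi θ χ K₀ g₀ K)
      (cutGrid θ.ν (histA₁₃Chi θ χ K₀ g₀ K) (K₀ + K) (ρ K) (selDepthA2₁₃Chi θ χ hP K₀ g₀ os ρ (n₁ K) K t + 1))
      (bCutGrid θ.ν θ.A₁ (histA₁₃Chi θ χ K₀ g₀ K) (K₀ + K - 1) (ρ' K) (selDepthB2₁₃Chi θ χ hP K₀ g₀ os ρ' (n₂ K) K t + 1)) t (K₀ + K) s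

/-- **RUN B's DOUBLY-GAPPED CLASS WEIGHT** at a key (top `K₀ + K + 1`, along `keyB₁₃Chi`, the SAME depths). [bookkeeping] -/
def gapWeight2B₁₃Chi (θ : Stage13HParams F N) (χ : ChiSlot F N) (hP : θ.Provisos₁₃CoPHChi F N χ) (K₀ : ℕ) (g₀ : ℕ → ℝ) (os : List (ULoop F)) (ρ ρ' : ℕ → ℝ) (n₁ n₂ : ℕ → ℕ)
    (K : ℕ) (t : ℝ) (x : Σ K, SiteSeqKey F (K₀ + K)) : ℝ :=
  letI : ∀ Kc, DecidableEq (SiteSeqKey F Kc) := fun _ => Classical.decEq _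
  ∑ s' ∈ univ.filter (fun s' => keyB₁₃Chi θ χ K₀ g₀ K s' = x),
    topTerm2AtLevel F N θ.toStage9Params (datumOfRecord₁₃CoPHChi F N θ χ hP) g₀ os (runB₁₃ F K₀ g₀ K) (histB₁₃Chi θ χ K₀ g₀ K)
      (cutGrid θ.ν (histB₁₃Chi θ χ K₀ g₀ K) (K₀ + K + 1) (ρ K) (selDepthA2₁₃Chi θ χ hP K₀ g₀ os ρ (n₁ K) K t + 1))
      (bCutGrid θ.ν θ.A₁ (histB₁₃Chi θ χ K₀ g₀ K) (K₀ + K) (ρ' K) (selDepthB2₁₃Chi θ χ hP K₀ g₀ os ρ' (n₂ K) K t + 1)) t (K₀ + K + 1) s'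

/-- **RUN A's TWO-COLLAR SHELL PART** at a key: the fibre sum of the two-collar shells at the selected depth pair. [bookkeeping] -/
def gapShell2A₁₃Chi (θ : Stage13HParams F N) (χ : ChiSlot F N) (hP : θ.Provisos₁₃CoPHChi F N χ) (K₀ : ℕ) (g₀ : ℕ → ℝ) (os : List (ULoop F)) (ρ ρ' : ℕ → ℝ) (n₁ n₂ : ℕ → ℕ)
    (K : ℕ) (t : ℝ) (x : Σ K, SiteSeqKey F (K₀ + K)) : ℝ :=
  letI : ∀ Kc, DecidableEq (SiteSeqKey F Kc) := fun _ => Classical.decEq _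
  ∑ s ∈ univ.filter (fun s => keyA₁₃Chi θ χ K₀ g₀ K s = x),
    topGap2ShellAtLevel F N θ.toStage9Params (datumOfRecord₁₃CoPHChi F N θ χ hP) g₀ os (runA₁₃ F K₀ g₀ K) (histA₁₃Chi θ χ K₀ g₀ K)
      (cutGrid θ.ν (histA₁₃Chi θ χ K₀ g₀ K) (K₀ + K) (ρ K) (selDepthA2₁₃Chi θ χ hP K₀ g₀ os ρ (n₁ K) K t + 2))
      (cutGrid θ.ν (histA₁₃Chi θ χ K₀ g₀ K) (K₀ + K) (ρ K) (selDepthA2₁₃Chi θ χ hP K₀ g₀ os ρ (n₁ K) K t + 1))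
      (cutGrid θ.ν (histA₁₃Chi θ χ K₀ g₀ K) (K₀ + K) (ρ K) (selDepthA2₁₃Chi θ χ hP K₀ g₀ os ρ (n₁ K) K t))
      (bCutGrid θ.ν θ.A₁ (histA₁₃Chi θ χ K₀ g₀ K) (K₀ + K - 1) (ρ' K) (selDepthB2₁₃Chi θ χ hP K₀ g₀ os ρ' (n₂ K) K t + 2))
      (bCutGrid θ.ν θ.A₁ (histA₁₃Chi θ χ K₀ g₀ K) (K₀ + K - 1) (ρ' K) (selDepthB2₁₃Chi θ χ hP K₀ g₀ os ρ' (n₂ K) K t + 1))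
      (bCutGrid θ.ν θ.A₁ (histA₁₃Chi θ χ K₀ g₀ K) (K₀ + K - 1) (ρ' K) (selDepthB2₁₃Chi θ χ hP K₀ g₀ os ρ' (n₂ K) K t)) t (K₀ + K) s

/-- **RUN B's TWO-COLLAR SHELL PART** at a key. [bookkeeping] -/
def gapShell2B₁₃Chi (θ : Stage13HParams F N) (χ : ChiSlot F N) (hP : θ.Provisos₁₃CoPHChi F N χ) (K₀ : ℕ) (g₀ : ℕ → ℝ) (os : List (ULoop F)) (ρ ρ' : ℕ → ℝ) (n₁ n₂ : ℕ → ℕ)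
    (K : ℕ) (t : ℝ) (x : Σ K, SiteSeqKey F (K₀ + K)) : ℝ :=
  letI : ∀ Kc, DecidableEq (SiteSeqKey F Kc) := fun _ => Classical.decEq _
  ∑ s' ∈ univ.filter (fun s' => keyB₁₃Chi θ χ K₀ g₀ K s' = x),
    topGap2ShellAtLevel F N θ.toStage9Params (datumOfRecord₁₃CoPHChi F N θ χ hP) g₀ os (runB₁₃ F K₀ g₀ K) (histB₁₃Chi θ χ K₀ g₀ K)
      (cutGrid θ.ν (histB₁₃Chi θ χ K₀ g₀ K) (K₀ + K + 1) (ρ K) (selDepthA2₁₃Chi θ χ hP K₀ g₀ os ρ (n₁ K) K t + 2))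
      (cutGrid θ.ν (histB₁₃Chi θ χ K₀ g₀ K) (K₀ + K + 1) (ρ K) (selDepthA2₁₃Chi θ χ hP K₀ g₀ os ρ (n₁ K) K t + 1))
      (cutGrid θ.ν (histB₁₃Chi θ χ K₀ g₀ K) (K₀ + K + 1) (ρ K) (selDepthA2₁₃Chi θ χ hP K₀ g₀ os ρ (n₁ K) K t))
      (bCutGrid θ.ν θ.A₁ (histB₁₃Chi θ χ K₀ g₀ K) (K₀ + K) (ρ' K) (selDepthB2₁₃Chi θ χ hP K₀ g₀ os ρ' (n₂ K) K t + 2))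
      (bCutGrid θ.ν θ.A₁ (histB₁₃Chi θ χ K₀ g₀ K) (K₀ + K) (ρ' K) (selDepthB2₁₃Chi θ χ hP K₀ g₀ os ρ' (n₂ K) K t + 1))
      (bCutGrid θ.ν θ.A₁ (histB₁₃Chi θ χ K₀ g₀ K) (K₀ + K) (ρ' K) (selDepthB2₁₃Chi θ χ hP K₀ g₀ os ρ' (n₂ K) K t)) t (K₀ + K + 1) s'

/-- **RUN A's DOUBLY-GAPPED CORE at a key** — equals `gapWeight2A₁₃Chi − gapShell2A₁₃Chi` (below; the object N19′ matches on this road). [bookkeeping] -/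
def gapCore2A₁₃Chi (θ : Stage13HParams F N) (χ : ChiSlot F N) (hP : θ.Provisos₁₃CoPHChi F N χ) (K₀ : ℕ) (g₀ : ℕ → ℝ) (os : List (ULoop F)) (ρ ρ' : ℕ → ℝ) (n₁ n₂ : ℕ → ℕ)
    (K : ℕ) (t : ℝ) (x : Σ K, SiteSeqKey F (K₀ + K)) : ℝ :=
  letI : ∀ Kc, DecidableEq (SiteSeqKey F Kc) := fun _ => Classical.decEq _
  ∑ s ∈ univ.filter (fun s => keyA₁₃Chi θ χ K₀ g₀ K s = x),
    topGap2CoreAtLevel F N θ.toStage9Params (datumOfRecord₁₃CoPHChi F N θ χ hP) g₀ os (runA₁₃ F K₀ g₀ K) (histA₁₃Chi θ χ K₀ g₀ K)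
      (cutGrid θ.ν (histA₁₃Chi θ χ K₀ g₀ K) (K₀ + K) (ρ K) (selDepthA2₁₃Chi θ χ hP K₀ g₀ os ρ (n₁ K) K t + 2))
      (cutGrid θ.ν (histA₁₃Chi θ χ K₀ g₀ K) (K₀ + K) (ρ K) (selDepthA2₁₃Chi θ χ hP K₀ g₀ os ρ (n₁ K) K t))
      (bCutGrid θ.ν θ.A₁ (histA₁₃Chi θ χ K₀ g₀ K) (K₀ + K - 1) (ρ' K) (selDepthB2₁₃Chi θ χ hP K₀ g₀ os ρ' (n₂ K) K t + 2))
      (bCutGrid θ.ν θ.A₁ (histA₁₃Chi θ χ K₀ g₀ K) (K₀ + K - 1) (ρ' K) (selDepthB2₁₃Chi θ χ hP K₀ g₀ os ρ' (n₂ K) K t)) t (K₀ + K) s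

/-- **RUN B's DOUBLY-GAPPED CORE at a key.** [bookkeeping] -/
def gapCore2B₁₃Chi (θ : Stage13HParams F N) (χ : ChiSlot F N) (hP : θ.Provisos₁₃CoPHChi F N χ) (K₀ : ℕ) (g₀ : ℕ → ℝ) (os : List (ULoop F)) (ρ ρ' : ℕ → ℝ) (n₁ n₂ : ℕ → ℕ)
    (K : ℕ) (t : ℝ) (x : Σ K, SiteSeqKey F (K₀ + K)) : ℝ :=
  letI : ∀ Kc, DecidableEq (SiteSeqKey F Kc) := fun _ => Classical.decEq _
  ∑ s' ∈ univ.filter (fun s' => keyB₁₃Chi θ χ K₀ g₀ K s' = x),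
    topGap2CoreAtLevel F N θ.toStage9Params (datumOfRecord₁₃CoPHChi F N θ χ hP) g₀ os (runB₁₃ F K₀ g₀ K) (histB₁₃Chi θ χ K₀ g₀ K)
      (cutGrid θ.ν (histB₁₃Chi θ χ K₀ g₀ K) (K₀ + K + 1) (ρ K) (selDepthA2₁₃Chi θ χ hP K₀ g₀ os ρ (n₁ K) K t + 2))
      (cutGrid θ.ν (histB₁₃Chi θ χ K₀ g₀ K) (K₀ + K + 1) (ρ K) (selDepthA2₁₃Chi θ χ hP K₀ g₀ os ρ (n₁ K) K t))
      (bCutGrid θ.ν θ.A₁ (histB₁₃Chi θ χ K₀ g₀ K) (K₀ + K) (ρ' K) (selDepthB2₁₃Chi θ χ hP K₀ g₀ os ρ' (n₂ K) K t + 2))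
      (bCutGrid θ.ν θ.A₁ (histB₁₃Chi θ χ K₀ g₀ K) (K₀ + K) (ρ' K) (selDepthB2₁₃Chi θ χ hP K₀ g₀ os ρ' (n₂ K) K t)) t (K₀ + K + 1) s'

/-- ★★ **RUN A: DOUBLY-GAPPED CLASS WEIGHT − TWO-COLLAR SHELL PART = DOUBLY-GAPPED CORE**, key by key, identically (no rows). [bookkeeping] -/
theorem gapWeight2A₁₃Chi_sub_gapShell2A₁₃ (θ : Stage13HParams F N) (χ : ChiSlot F N) (hP : θ.Provisos₁₃CoPHChi F N χ) (K₀ : ℕ) (g₀ : ℕ → ℝ) (os : List (ULoop F)) (ρ ρ' : ℕ → ℝ)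
    (n₁ n₂ : ℕ → ℕ) (K : ℕ) (t : ℝ) (x : Σ K, SiteSeqKey F (K₀ + K)) :
    gapWeight2A₁₃Chi θ χ hP K₀ g₀ os ρ ρ' n₁ n₂ K t x - gapShell2A₁₃Chi θ χ hP K₀ g₀ os ρ ρ' n₁ n₂ K t x = gapCore2A₁₃Chi θ χ hP K₀ g₀ os ρ ρ' n₁ n₂ K t x := by
  letI : ∀ Kc, DecidableEq (SiteSeqKey F Kc) := fun _ => Classical.decEq _
  unfold gapWeight2A₁₃Chi gapShell2A₁₃Chi gapCore2A₁₃Chi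
  rw [← Finset.sum_sub_distrib]
  exact Finset.sum_congr rfl fun s _ =>
    topTerm2AtLevel_sub_topGap2ShellAtLevel F N θ.toStage9Params (datumOfRecord₁₃CoPHChi F N θ χ hP) g₀ os (runA₁₃ F K₀ g₀ K) (histA₁₃Chi θ χ K₀ g₀ K) _ _ _ _ _ _ t (K₀ + K) s

/-- ★★ **RUN B: the same.** [bookkeeping] -/
theorem gapWeight2B₁₃Chi_sub_gapShell2B₁₃ (θ : Stage13HParams F N) (χ : ChiSlot F N) (hP : θ.Provisos₁₃CoPHChi F N χ) (K₀ : ℕ) (g₀ : ℕ → ℝ) (os : List (ULoop F)) (ρ ρ' : ℕ → ℝ)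
    (n₁ n₂ : ℕ → ℕ) (K : ℕ) (t : ℝ) (x : Σ K, SiteSeqKey F (K₀ + K)) :
    gapWeight2B₁₃Chi θ χ hP K₀ g₀ os ρ ρ' n₁ n₂ K t x - gapShell2B₁₃Chi θ χ hP K₀ g₀ os ρ ρ' n₁ n₂ K t x = gapCore2B₁₃Chi θ χ hP K₀ g₀ os ρ ρ' n₁ n₂ K t x := by
  letI : ∀ Kc, DecidableEq (SiteSeqKey F Kc) := fun _ => Classical.decEq _
  unfold gapWeight2B₁₃Chi gapShell2B₁₃Chi gapCore2B₁₃Chi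
  rw [← Finset.sum_sub_distrib]
  exact Finset.sum_congr rfl fun s' _ =>
    topTerm2AtLevel_sub_topGap2ShellAtLevel F N θ.toStage9Params (datumOfRecord₁₃CoPHChi F N θ χ hP) g₀ os (runB₁₃ F K₀ g₀ K) (histB₁₃Chi θ χ K₀ g₀ K) _ _ _ _ _ _ t (K₀ + K + 1) s'

/-! ## §D4 The doubly-gapped spine reading -/

variable (Χ) in
/-- ★★ **THE DOUBLY-GAPPED SPINE READING AT OFFSET `K₀`** (persistence policy `jcut`, width letters `ρ, ρ′`, depth letters `n₁, n₂`): the lane owner's `crGap₁₃VAt` field for field —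
index type, class set, bad class, `l₀ := 1`, `vol := F.side ^ 4`, canonical `W ∕ Wsh ∕ δ` — with the DOUBLY-GAPPED carriers `gapWeight2A∕B₁₃ ∕ gapShell2A∕B₁₃`. [bookkeeping] -/
def crGap2₁₃VAtCmap (K₀ : ℕ) (jcut : ℕ → ℕ) (ρ ρ' : WidthLetter₁₃CoPHCmap N Χ) (n₁ n₂ : DepthLetter₁₃CoPHCmap N Χ) : SpineReading₁₃CoPHCmap N Χ := fun F θ hP g₀ os =>
  { ι := Σ K, SiteSeqKey F (K₀ + K)
    dec := Classical.decEq _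
    l₀ := 1
    vol := F.side ^ 4
    K₀ := K₀
    T := classSet₁₃Chi θ (Χ F θ.toStage13Params) K₀ g₀
    A := gapWeight2A₁₃Chi θ (Χ F θ.toStage13Params) hP K₀ g₀ os (ρ F θ hP g₀ os) (ρ' F θ hP g₀ os) (n₁ F θ hP g₀ os) (n₂ F θ hP g₀ os)
    B := gapWeight2B₁₃Chi θ (Χ F θ.toStage13Params) hP K₀ g₀ os (ρ F θ hP g₀ os) (ρ' F θ hP g₀ os) (n₁ F θ hP g₀ os) (n₂ F θ hP g₀ os)
    shA := gapShell2A₁₃Chi θ (Χ F θ.toStage13Params) hP K₀ g₀ os (ρ F θ hP g₀ os) (ρ' F θ hP g₀ os) (n₁ F θ hP g₀ os) (n₂ F θ hP g₀ os)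
    shB := gapShell2B₁₃Chi θ (Χ F θ.toStage13Params) hP K₀ g₀ os (ρ F θ hP g₀ os) (ρ' F θ hP g₀ os) (n₁ F θ hP g₀ os) (n₂ F θ hP g₀ os)
    Bad := badClass₁₃Chi θ (Χ F θ.toStage13Params) K₀ g₀ jcut
    W := wInf 1 (classSet₁₃Chi θ (Χ F θ.toStage13Params) K₀ g₀) (gapWeight2A₁₃Chi θ (Χ F θ.toStage13Params) hP K₀ g₀ os (ρ F θ hP g₀ os) (ρ' F θ hP g₀ os) (n₁ F θ hP g₀ os) (n₂ F θ hP g₀ os))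
      (gapWeight2B₁₃Chi θ (Χ F θ.toStage13Params) hP K₀ g₀ os (ρ F θ hP g₀ os) (ρ' F θ hP g₀ os) (n₁ F θ hP g₀ os) (n₂ F θ hP g₀ os)) (badClass₁₃Chi θ (Χ F θ.toStage13Params) K₀ g₀ jcut)
    Wsh := wshInf 1 (classSet₁₃Chi θ (Χ F θ.toStage13Params) K₀ g₀) (gapWeight2A₁₃Chi θ (Χ F θ.toStage13Params) hP K₀ g₀ os (ρ F θ hP g₀ os) (ρ' F θ hP g₀ os) (n₁ F θ hP g₀ os) (n₂ F θ hP g₀ os))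
      (gapWeight2B₁₃Chi θ (Χ F θ.toStage13Params) hP K₀ g₀ os (ρ F θ hP g₀ os) (ρ' F θ hP g₀ os) (n₁ F θ hP g₀ os) (n₂ F θ hP g₀ os))
      (gapShell2A₁₃Chi θ (Χ F θ.toStage13Params) hP K₀ g₀ os (ρ F θ hP g₀ os) (ρ' F θ hP g₀ os) (n₁ F θ hP g₀ os) (n₂ F θ hP g₀ os))
      (gapShell2B₁₃Chi θ (Χ F θ.toStage13Params) hP K₀ g₀ os (ρ F θ hP g₀ os) (ρ' F θ hP g₀ os) (n₁ F θ hP g₀ os) (n₂ F θ hP g₀ os))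
    δ := letI : DecidableEq (Σ K, SiteSeqKey F (K₀ + K)) := Classical.decEq _
      deltaCan 1 (F.side ^ 4) (classSet₁₃Chi θ (Χ F θ.toStage13Params) K₀ g₀) (badClass₁₃Chi θ (Χ F θ.toStage13Params) K₀ g₀ jcut)
        (fun K t x => gapWeight2A₁₃Chi θ (Χ F θ.toStage13Params) hP K₀ g₀ os (ρ F θ hP g₀ os) (ρ' F θ hP g₀ os) (n₁ F θ hP g₀ os) (n₂ F θ hP g₀ os) K t x -
          gapShell2A₁₃Chi θ (Χ F θ.toStage13Params) hP K₀ g₀ os (ρ F θ hP g₀ os) (ρ' F θ hP g₀ os) (n₁ F θ hP g₀ os) (n₂ F θ hP g₀ os) K t x)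
        (fun K t x => gapWeight2B₁₃Chi θ (Χ F θ.toStage13Params) hP K₀ g₀ os (ρ F θ hP g₀ os) (ρ' F θ hP g₀ os) (n₁ F θ hP g₀ os) (n₂ F θ hP g₀ os) K t x -
          gapShell2B₁₃Chi θ (Χ F θ.toStage13Params) hP K₀ g₀ os (ρ F θ hP g₀ os) (ρ' F θ hP g₀ os) (n₁ F θ hP g₀ os) (n₂ F θ hP g₀ os) K t x) }

variable (Χ) in
/-- ★★ **THE DOUBLY-GAPPED SPINE READING** `crGap2₁₃VCmap := crGap2₁₃VAtCmap 0`. [bookkeeping] -/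
def crGap2₁₃VCmap (jcut : ℕ → ℕ) (ρ ρ' : WidthLetter₁₃CoPHCmap N Χ) (n₁ n₂ : DepthLetter₁₃CoPHCmap N Χ) : SpineReading₁₃CoPHCmap N Χ :=
  crGap2₁₃VAtCmap Χ 0 jcut ρ ρ' n₁ n₂

/-! ### The dictionary (all `rfl`) -/

section Dictionary2

variable (K₀ : ℕ) (jcut : ℕ → ℕ) (ρ ρ' : WidthLetter₁₃CoPHCmap N Χ) (n₁ n₂ : DepthLetter₁₃CoPHCmap N Χ) (θ : Stage13HParams F N) (hP : θ.Provisos₁₃CoPHChi F N (Χ F θ.toStage13Params)) (g₀ : ℕ → ℝ)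
  (os : List (ULoop F))

/-- `ι`. [bookkeeping] -/
theorem crGap2₁₃VAtCmap_ι : (crGap2₁₃VAtCmap Χ K₀ jcut ρ ρ' n₁ n₂ F θ hP g₀ os).ι = (Σ K, SiteSeqKey F (K₀ + K)) := rfl
/-- `l₀ = 1`. [bookkeeping] -/
@[simp] theorem crGap2₁₃VAtCmap_l₀ : (crGap2₁₃VAtCmap Χ K₀ jcut ρ ρ' n₁ n₂ F θ hP g₀ os).l₀ = 1 := rfl
/-- `vol = F.side ^ 4`. [bookkeeping] -/
theorem crGap2₁₃VAtCmap_vol : (crGap2₁₃VAtCmap Χ K₀ jcut ρ ρ' n₁ n₂ F θ hP g₀ os).vol = F.side ^ 4 := rfl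
/-- `K₀`. [bookkeeping] -/
@[simp] theorem crGap2₁₃VAtCmap_K₀ : (crGap2₁₃VAtCmap Χ K₀ jcut ρ ρ' n₁ n₂ F θ hP g₀ os).K₀ = K₀ := rfl
/-- `T` = n20-d's keyed class set of record. [bookkeeping] -/
theorem crGap2₁₃VAtCmap_T : (crGap2₁₃VAtCmap Χ K₀ jcut ρ ρ' n₁ n₂ F θ hP g₀ os).T = classSet₁₃Chi θ (Χ F θ.toStage13Params) K₀ g₀ := rfl
/-- `A` = run A's doubly-gapped fibre sums. [bookkeeping] -/
theorem crGap2₁₃VAtCmap_A : (crGap2₁₃VAtCmap Χ K₀ jcut ρ ρ' n₁ n₂ F θ hP g₀ os).A =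
    gapWeight2A₁₃Chi θ (Χ F θ.toStage13Params) hP K₀ g₀ os (ρ F θ hP g₀ os) (ρ' F θ hP g₀ os) (n₁ F θ hP g₀ os) (n₂ F θ hP g₀ os) := rfl
/-- `B` = run B's doubly-gapped fibre sums. [bookkeeping] -/
theorem crGap2₁₃VAtCmap_B : (crGap2₁₃VAtCmap Χ K₀ jcut ρ ρ' n₁ n₂ F θ hP g₀ os).B =
    gapWeight2B₁₃Chi θ (Χ F θ.toStage13Params) hP K₀ g₀ os (ρ F θ hP g₀ os) (ρ' F θ hP g₀ os) (n₁ F θ hP g₀ os) (n₂ F θ hP g₀ os) := rfl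
/-- `shA` = run A's two-collar shell part. [bookkeeping] -/
theorem crGap2₁₃VAtCmap_shA : (crGap2₁₃VAtCmap Χ K₀ jcut ρ ρ' n₁ n₂ F θ hP g₀ os).shA =
    gapShell2A₁₃Chi θ (Χ F θ.toStage13Params) hP K₀ g₀ os (ρ F θ hP g₀ os) (ρ' F θ hP g₀ os) (n₁ F θ hP g₀ os) (n₂ F θ hP g₀ os) := rfl
/-- `shB` = run B's two-collar shell part. [bookkeeping] -/
theorem crGap2₁₃VAtCmap_shB : (crGap2₁₃VAtCmap Χ K₀ jcut ρ ρ' n₁ n₂ F θ hP g₀ os).shB =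
    gapShell2B₁₃Chi θ (Χ F θ.toStage13Params) hP K₀ g₀ os (ρ F θ hP g₀ os) (ρ' F θ hP g₀ os) (n₁ F θ hP g₀ os) (n₂ F θ hP g₀ os) := rfl
/-- `Bad` = n20-d's persistence class of record. [bookkeeping] -/
theorem crGap2₁₃VAtCmap_Bad : (crGap2₁₃VAtCmap Χ K₀ jcut ρ ρ' n₁ n₂ F θ hP g₀ os).Bad = badClass₁₃Chi θ (Χ F θ.toStage13Params) K₀ g₀ jcut := rfl
/-- The record object reads the offset-`0` form (`rfl`). [bookkeeping] -/
theorem crGap2₁₃VCmap_eq : crGap2₁₃VCmap Χ jcut ρ ρ' n₁ n₂ = crGap2₁₃VAtCmap Χ 0 jcut ρ ρ' n₁ n₂ := rfl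
end Dictionary2

end Reading2

/-! ## §R Receipt at the record's own β-slot `Χ := chiβOfRecord₁₃` (definitional) -/

section Receipts

variable {F : T4Family} {N : ℕ} [NeZero N] (θ : Stage13HParams F N) (hP : θ.Provisos₁₃CoPHChi F N (chiβOfRecord₁₃ F N θ.toStage13Params)) (K₀ : ℕ) (g₀ : ℕ → ℝ)
  (os : List (ULoop F))

/-- Receipt: the χ-doubly-gapped reading at `Χ := chiβOfRecord₁₃` IS `crGap2₁₃VAt` at the transported provisos and the four letters read back through them. [bookkeeping] -/
theorem crGap2₁₃VAtCmap_chiβ (jcut : ℕ → ℕ) (ρ ρ' : WidthLetter₁₃CoPH N) (n₁ n₂ : DepthLetter₁₃CoPH N) :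
    crGap2₁₃VAtCmap (fun F => chiβOfRecord₁₃ F N) K₀ jcut (fun F θ h g₀ os => ρ F θ ((provisos₁₃CoPHChi_chiβ_iff θ).1 h) g₀ os)
        (fun F θ h g₀ os => ρ' F θ ((provisos₁₃CoPHChi_chiβ_iff θ).1 h) g₀ os) (fun F θ h g₀ os => n₁ F θ ((provisos₁₃CoPHChi_chiβ_iff θ).1 h) g₀ os)
        (fun F θ h g₀ os => n₂ F θ ((provisos₁₃CoPHChi_chiβ_iff θ).1 h) g₀ os) F θ hP g₀ os =
      crGap2₁₃VAt N K₀ jcut ρ ρ' n₁ n₂ F θ ((provisos₁₃CoPHChi_chiβ_iff θ).1 hP) g₀ os := rfl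

end Receipts

/-! ## §A The RE-CENTRED instances (`χ := chiβOfRecord₁₃Ax θ`) -/

section Ax

variable {F : T4Family} {N : ℕ} [NeZero N]

/-- ★★ The doubly-gapped spine reading at offset `K₀`, RE-CENTRED (the K3ᴬ v8 `PinnedAtLiveGap2 ∕ DialRows` object). [bookkeeping] -/
abbrev crGap2₁₃VAtAx (K₀ : ℕ) (jcut : ℕ → ℕ) (ρ ρ' : WidthLetter₁₃CoPHAx N) (n₁ n₂ : DepthLetter₁₃CoPHAx N) : SpineReading₁₃CoPHAx N :=
  crGap2₁₃VAtCmap (fun F => chiβOfRecord₁₃Ax F N) K₀ jcut ρ ρ' n₁ n₂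

/-- ★★ The doubly-gapped spine reading, RE-CENTRED. [bookkeeping] -/
abbrev crGap2₁₃VAx (jcut : ℕ → ℕ) (ρ ρ' : WidthLetter₁₃CoPHAx N) (n₁ n₂ : DepthLetter₁₃CoPHAx N) : SpineReading₁₃CoPHAx N :=
  crGap2₁₃VCmap (fun F => chiβOfRecord₁₃Ax F N) jcut ρ ρ' n₁ n₂

end Ax

end Summit.QuantumFields.YangMills.Theorems.N21GappedTopPair13CoPH

end
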